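import Literature.AnabelianGeometry.EtaleTheta.TemperedFrobenioidToy
import Literature.AnabelianGeometry.EtaleTheta.Discharge.Sec3Remark364Holds
import HarnessLib

/-!
# [EtTh] Remark 3.6.4 (perfection clause) as the schema `TemperedFrobenioid.Remark364` over an ARBITRARY
# [FrdI]-vocabulary stub: the universal closure AS TYPED is false (kernel witness)

S. Mochizuki, *The étale theta function and its Frobenioid-theoretic manifestations*, Publ. RIMS **45**
(2009), §3, Remark 3.6.4 p. 79: "the perfection and realification of a tempered Frobenioid are again
tempered Frobenioids" [cite: MochizukiEtTh2009, Rmk 3.6.4 p.79].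

PROOF-ONLY companion (no definitions, no instances) of `TemperedFrobenioidProps.lean` (seat abc-iut-L2-t3);
cell abc-iut, block F, seat abc-iut-f-045.  FACT-LIST row **F-0582** `TemperedFrobenioid.Remark364 C₀ :=
∀ A, IsGroupSaturated (Φ(A)^pf) ∧ V.IsPerfFactorial (Φ(A)^pf) ∧ IsMonoprime ((Φ^pf)^{bs-fld}(A))` for a
tempered Frobenioid `C₀` over a realified datum `T : RealifiedDivisorMonoids V` — PARAMETRIC in the
hypothesis structure `V : FrdIMonoidStub` whose predicate `IsPerfFactorial` is FREE; the middle conjunct asks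
that free predicate of the perf-saturation, and no axiom relates it to `V.IsPerfFactorial (Φ(A))` (field
`isPerfFactorial` of `TemperedFrobenioid`).  Discharge of record: `TemperedFrobenioid.Remark364_holds` for
every `C₀` over THE vocabulary `treeMonoidVocab` (`Discharge/Sec3Remark364Holds.lean`; R7 kernel
TYPE-audit abc-iut-w5-d199 v2: «binders 7 vs 8», no theorem over all `V`).  Kernel content:
* `not_forall_remark364` — the universal closure is FALSE: over the one-object base and the data
  `Φ₀ = ℕ`, `B₀ = ℤ` of abc-iut's `Toy.divisorMonoids`, take the junk vocabulary `IsPerfFactorial M :≡ "M has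
  an element that is not a square"` (other predicates `⊤`), the "realification" `Φ^{ℝ-log} := ℚ_{≥0} ⊋ Φ := ℕ`
  (group-saturated; `1 ∈ ℕ` is not a double, so `Φ(A)` is "perf-factorial"; `Φ^{bs-fld} = ℕ` is
  `ℤ`-monoprime; `div(1) = 𝔭 ≠ 0`), a genuine `TemperedFrobenioid` of the typed interface; but the
  perf-saturation of `ℕ` in `ℚ_{≥0}` is all of `ℚ_{≥0}`, where every element is a double.
Instance of record: `Remark364_holds` at `treeMonoidVocab`.  So F-0582 is admissible AT THE NAMED INSTANCE
ONLY (R5); refuted-closure ≠ refuted-paper (the junk predicate is not [FrdI]'s "perf-factorial"); a FACT row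
is an assumption label, not an endorsement; nothing here bears on [IUTchIII] Cor. 3.12.
-/

noncomputable section

namespace Literature.AnabelianGeometry.EtaleTheta

open CategoryTheory Opposite Literature.AlgebraicGeometry.Frobenioids

/-- `gpMap id = id`, pointwise (transition maps of constant functors). [folklore] -/
private theorem gpMap_id_apply' {M : Type} [CommMonoid M] (x : Algebra.GrothendieckGroup M) :
    gpMap (MonoidHom.id M) x = x :=
  DFunLike.congr_fun (Literature.AlgebraicGeometry.Frobenioids.gpMap_id (M := M)) x

/-- The inclusion `ℕ ↪ ℚ_{≥0}`, multiplicatively written, has group-saturated image: `q + b = a` with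
`a, b ∈ ℕ` forces `q = a - b ∈ ℕ`. [cite: MochizukiEtTh2009, §0 p.8] -/
theorem isGroupSaturated_mrange_natCast_nnrat :
    IsGroupSaturated (MonoidHom.mrange
      (AddMonoidHom.toMultiplicative (Nat.castAddMonoidHom NNRat) :
        Multiplicative ℕ →* Multiplicative NNRat)) := by
  refine (isGroupSaturated_iff' _).2 fun q a ha b hb h => ?_
  obtain ⟨m, rfl⟩ := MonoidHom.mem_mrange.mp ha
  obtain ⟨n, rfl⟩ := MonoidHom.mem_mrange.mp hb
  have h' : Multiplicative.toAdd q + ((Multiplicative.toAdd n : ℕ) : NNRat) =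
      ((Multiplicative.toAdd m : ℕ) : NNRat) := by
    have := congrArg Multiplicative.toAdd h
    simpa only [toAdd_mul, AddMonoidHom.toMultiplicative_apply_apply, toAdd_ofAdd,
      Nat.coe_castAddMonoidHom] using this
  refine MonoidHom.mem_mrange.mpr
    ⟨Multiplicative.ofAdd ((Multiplicative.toAdd m : ℕ) - Multiplicative.toAdd n), ?_⟩
  apply Multiplicative.toAdd.injective
  rw [AddMonoidHom.toMultiplicative_apply_apply, toAdd_ofAdd, toAdd_ofAdd, Nat.coe_castAddMonoidHom,
    Nat.cast_tsub, ← h', add_tsub_cancel_right]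

/-- **F-0582, universal closure REFUTED.**  See the module docstring: a tempered Frobenioid of the typed
interface with `Φ = ℕ ⊊ Φ^{ℝ-log} = ℚ_{≥0}` over the junk vocabulary "has a non-square"; its perf-saturation
`ℚ_{≥0}` has none.  Instance of record: `TemperedFrobenioid.Remark364_holds` (`V := treeMonoidVocab`).
[cite: MochizukiEtTh2009, Rmk 3.6.4 p.79] -/
theorem not_forall_remark364 :
    ¬ ∀ {D₀ : Type} [Category.{0} D₀] {V : FrdIMonoidStub.{0}} {T : RealifiedDivisorMonoids (D₀ := D₀) V}
        {D : Type} [Category.{0} D] {VD : FrdICatStub.{0, 0, 0} D} (C : TemperedFrobenioid T D VD),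
        C.Remark364 := by
  intro h
  -- the junk vocabulary: "perf-factorial" := has an element that is not a square
  let V : FrdIMonoidStub.{0} :=
    { IsPerfFactorial := fun M _ => ∃ x : M, ∀ y : M, y * y ≠ x
      IsRealification := fun _ _ _ _ _ => True
      RSupports := fun _ _ => True
      IsNonDilating := fun _ _ _ => True }
  -- `ℕ ↪ ℚ≥0`
  let ι : Multiplicative ℕ →* Multiplicative NNRat :=
    AddMonoidHom.toMultiplicative (Nat.castAddMonoidHom NNRat)
  have hι : Function.Injective ι := fun a b hab => by
    have := congrArg Multiplicative.toAdd hab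
    simp only [ι, AddMonoidHom.toMultiplicative_apply_apply, toAdd_ofAdd, Nat.coe_castAddMonoidHom,
      Nat.cast_inj] at this
    exact Multiplicative.toAdd.injective this
  -- the realified datum: `Φ₀ = ℕ → Φ^{ℝ-log} := ℚ≥0`, `B^Λ = ℤ`, `div(1) = 𝔭`, `ℝ·Φ₀^cnst = everything`
  let p : Algebra.GrothendieckGroup (Multiplicative NNRat) :=
    Algebra.GrothendieckGroup.of (ι (Multiplicative.ofAdd 1))
  let T : RealifiedDivisorMonoids (D₀ := Discrete PUnit.{1}) V :=
    { toDivisorMonoids := Toy.divisorMonoids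
      Λ := MonoidType.Z
      ΦR := (Functor.const _).obj (CommMonCat.of (Multiplicative NNRat))
      toR := fun _ => ι
      toR_natural := fun _ _ => rfl
      isRealification := fun _ => trivial
      BΛ := (Functor.const _).obj (CommMonCat.of (Multiplicative ℤ))
      isUnit_BΛ := fun _ b => by
        change IsUnit (M := Multiplicative ℤ) b
        exact Group.isUnit _
      divΛ := fun _ => zpowersHom _ p
      divΛ_natural := fun _ b => (gpMap_id_apply' (zpowersHom _ p b)).symm
      FΛ := fun _ => ⊤
      FΛ_map := fun _ _ _ => trivial
      cnstR := fun _ => ⊤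
      cnstR_map := fun _ _ _ => trivial
      divΛ_mem_cnstR := fun _ _ _ => trivial
      cnstR_root := fun _ _ _ _ => trivial
      cnst_le_cnstR := fun _ _ _ => trivial
      ncspR := fun _ => ⊤
      cspR := fun _ => ⊥
      toR_ncsp := fun _ _ _ => trivial
      toR_csp := fun _ x hx => by
        have hx' : x = 1 := Submonoid.mem_bot.mp hx
        rw [Submonoid.mem_bot, hx', map_one] }
  -- `Φ(A) := ℕ ⊆ ℚ≥0`, the same submonoid at the unique object
  let P : Submonoid (Multiplicative NNRat) := MonoidHom.mrange ι
  have hPinf : P ⊓ (⊤ : Subgroup (Algebra.GrothendieckGroup (Multiplicative NNRat))).toSubmonoid.comap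
      (Algebra.GrothendieckGroup.of (M := Multiplicative NNRat)) = P := by
    rw [Subgroup.top_toSubmonoid, Submonoid.comap_top, inf_top_eq]
  have hPmono : IsMonoprime ↥(P ⊓ (⊤ : Subgroup (Algebra.GrothendieckGroup (Multiplicative NNRat))).toSubmonoid.comap
      (Algebra.GrothendieckGroup.of (M := Multiplicative NNRat))) := by
    rw [hPinf]
    exact IsMonoprime.ofZ ⟨⟨(MulEquiv.ofBijective ι.mrangeRestrict
      ⟨fun a b hab => hι (congrArg Subtype.val hab), ι.mrangeRestrict_surjective⟩).symm⟩⟩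
  let C : TemperedFrobenioid T (Discrete PUnit.{1}) Toy.catVocab :=
    { isConnected := zigzag_isConnected fun j₁ j₂ => by rw [Subsingleton.elim j₁ j₂]
      isTotallyEpimorphic := ⟨fun f => ⟨fun _ _ _ => Subsingleton.elim _ _⟩⟩
      base := 𝟭 _
      Φ := ⟨fun _ => P, fun _ _ hx => hx⟩
      isGroupSaturated := fun _ => isGroupSaturated_mrange_natCast_nnrat
      isPerfFactorial := fun _ => by
        -- `1 ∈ ℕ` is not a double
        refine ⟨⟨ι (Multiplicative.ofAdd 1), ⟨_, rfl⟩⟩, ?_⟩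
        rintro ⟨_, ⟨m, rfl⟩⟩ hy
        have h1 : ι (m * m) = ι (Multiplicative.ofAdd 1) := by
          rw [map_mul]; exact congrArg Subtype.val hy
        have h2 := congrArg Multiplicative.toAdd (hι h1)
        rw [toAdd_mul, toAdd_ofAdd] at h2
        omega
      isDivisorialOn := trivial
      isMonoprime_bsFld := fun _ => hPmono
      exists_FΛ_div_ne := fun _ => ⟨(Multiplicative.ofAdd (1 : ℤ) : Multiplicative ℤ), trivial,
        ι (Multiplicative.ofAdd 1), ⟨_, rfl⟩, 1, one_mem _,
        fun h0 => by
          have := congrArg Multiplicative.toAdd (hι (h0.trans (map_one ι).symm))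
          simp at this,
        by
          change zpowersHom _ p (Multiplicative.ofAdd (1 : ℤ)) =
            p / Algebra.GrothendieckGroup.of (M := Multiplicative NNRat) 1
          rw [zpowersHom_apply, toAdd_ofAdd, zpow_one, map_one, div_one]⟩ }
  -- Remark 3.6.4 at the unique object: the perf-saturation of `ℕ` in `ℚ≥0` would have a non-square
  have hpf : ∃ x : ↥(perfSaturation P), ∀ y : ↥(perfSaturation P), y * y ≠ x :=
    (h C (op ⟨PUnit.unit⟩)).2.1
  obtain ⟨x, hx⟩ := hpf
  -- but it is all of `ℚ≥0` …
  have htop : ∀ q : Multiplicative NNRat, q ∈ perfSaturation P := fun q => by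
    refine (mem_perfSaturation_iff _ _).mpr ⟨⟨(Multiplicative.toAdd q).den, (Multiplicative.toAdd q).den_pos⟩,
      MonoidHom.mem_mrange.mpr ⟨Multiplicative.ofAdd (Multiplicative.toAdd q).num, ?_⟩⟩
    apply Multiplicative.toAdd.injective
    simp only [ι, AddMonoidHom.toMultiplicative_apply_apply, toAdd_ofAdd, Nat.coe_castAddMonoidHom,
      PNat.mk_coe, toAdd_pow, nsmul_eq_mul, NNRat.den_mul_eq_num]
  -- … where everything is a double
  let y : Multiplicative NNRat := Multiplicative.ofAdd (Multiplicative.toAdd (x : Multiplicative NNRat) / 2)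
  refine hx ⟨y, htop y⟩ (Subtype.ext ?_)
  change y * y = (x : Multiplicative NNRat)
  apply Multiplicative.toAdd.injective
  rw [toAdd_mul, toAdd_ofAdd, add_halves]

/-- The instance of record, restated as an `example` (nothing new): Remark 3.6.4 (perfection clause) HOLDS
for every tempered Frobenioid over the tree's vocabulary `treeMonoidVocab`.
[cite: MochizukiEtTh2009, Rmk 3.6.4 p.79] -/
example {D₀ : Type} [Category.{0} D₀] {T : RealifiedDivisorMonoids (D₀ := D₀) treeMonoidVocab.{0}}
    {D : Type} [Category.{0} D] {VD : FrdICatStub.{0, 0, 0} D} (C₀ : TemperedFrobenioid T D VD) :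
    C₀.Remark364 :=
  C₀.Remark364_holds

end Literature.AnabelianGeometry.EtaleTheta

end
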